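import Summits.Ventures.PercRepro.S1TriangleKernelSix
import Summits.Ventures.PercRepro.RankLevelSetCorankFiveCounts

/-!
# PercRepro — THE TRIANGLE KERNEL AT NULLITY `7`, THE LEMMAS (p8, gen 24; a feeder for S4 — the rows `≤ 36` of the
`q = 7` window)

With the kernel `s₃ ≤ 10` at nullity `6` (S1TriangleKernelSix), `s₃ ≥ 13` at nullity `7` forces, at the point `x` on
the fewest triangles, `m = 3`, `s₃ = 13` and `|U| ∈ {12, 13}` with `r(U) = |U| − 7` for `U = ⋃ triangles` — the
restriction step `ncard_sUnion_triangles_of_thirteen` here: the restriction `M ↾ U` has the same triangles, so its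
nullity is `7` (`≤ 5` gives `≤ 8`, `= 6` gives `≤ 10`, and it is `≤ 7` by the nullity cap), and `r(U) ≥ 5` by (C2),
(C3). Two more tools: `four_le_ncard_sdiff_closure` — a point `q ∈ U` off `cl(X)` on `≥ 3` triangles, each carrying a
second point off `cl(X)`, makes `|U ∖ cl(X)| ≥ 4`; and `false_of_forall_notMem_closure_star` — if no point of `Q = U ∖ St`
lies in `cl(St)` (the star of `x`), no triangle avoiding `x` has two star points, so the `6` star points off `x`, each on
`≥ 2` triangles avoiding `x`, give `≥ 12` such triangles, against `≤ 11`. Axioms: standard.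
-/

open scoped Matroid

namespace PercRepro

namespace S1

open Set

variable {α : Type}

/-- **The restriction step at nullity `7`.** If `s₃ ≥ 13` and `7 ≤ |U|` for `U = ⋃ triangles`, then `|U| = r(U) + 7` with
`r(U) ≥ 5`: the restriction `M ↾ U` has the same triangles, so its nullity is `≥ 7` (the kernels at nullities `≤ 6`) and
`≤ 7` (the nullity cap), and `r(U) ≥ 4` by (C2), hence `|U| ≥ 11` and `r(U) ≥ 5` by (C3). -/
theorem ncard_sUnion_triangles_of_thirteen (M : Matroid α) [M.Finite]
    (hC1 : ∀ L ⊆ M.E, M.eRk L = 2 → L.ncard ≤ 3)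
    (hC2 : ∀ X ⊆ M.E, M.eRk X ≤ 3 → X.ncard ≤ 6)
    (hC3 : ∀ X ⊆ M.E, M.eRk X ≤ 4 → X.ncard ≤ 10) (hd : M.E.encard = M.eRank + 7)
    (hs13 : 13 ≤ (ThmN.triangles M).ncard) (hU7 : 7 ≤ (⋃₀ ThmN.triangles M).ncard) :
    ∃ r : ℕ, 5 ≤ r ∧ M.eRk (⋃₀ ThmN.triangles M) = r ∧ (⋃₀ ThmN.triangles M).ncard = r + 7 := by
  classical
  have hUE : ⋃₀ ThmN.triangles M ⊆ M.E := by
    intro z hz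
    obtain ⟨C, hC, hzC⟩ := Set.mem_sUnion.1 hz
    exact hC.1.subset_ground hzC
  have hUfin : (⋃₀ ThmN.triangles M).Finite := M.ground_finite.subset hUE
  set R := M ↾ (⋃₀ ThmN.triangles M) with hR
  haveI hRfinite : R.Finite := _root_.Matroid.restrict_finite hUfin
  have hRtri : ThmN.triangles R = ThmN.triangles M := by
    ext C
    show R.IsCircuit C ∧ C.ncard = 3 ↔ M.IsCircuit C ∧ C.ncard = 3
    rw [hR, _root_.Matroid.restrict_isCircuit_iff hUE]
    constructor
    · rintro ⟨⟨hC, -⟩, h3⟩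
      exact ⟨hC, h3⟩
    · rintro ⟨hC, h3⟩
      exact ⟨⟨hC, fun z hz => Set.mem_sUnion.2 ⟨C, ⟨hC, h3⟩, hz⟩⟩, h3⟩
  have hRC1 : ∀ L ⊆ R.E, R.eRk L = 2 → L.ncard ≤ 3 := by
    intro L hL hr
    rw [hR, _root_.Matroid.restrict_ground_eq] at hL
    rw [hR, _root_.Matroid.restrict_eRk_eq M hL] at hr
    exact hC1 L (hL.trans hUE) hr
  have hRC2 : ∀ X ⊆ R.E, R.eRk X ≤ 3 → X.ncard ≤ 6 := by
    intro X hX hr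
    rw [hR, _root_.Matroid.restrict_ground_eq] at hX
    rw [hR, _root_.Matroid.restrict_eRk_eq M hX] at hr
    exact hC2 X (hX.trans hUE) hr
  have hRC3 : ∀ X ⊆ R.E, R.eRk X ≤ 4 → X.ncard ≤ 10 := by
    intro X hX hr
    rw [hR, _root_.Matroid.restrict_ground_eq] at hX
    rw [hR, _root_.Matroid.restrict_eRk_eq M hX] at hr
    exact hC3 X (hX.trans hUE) hr
  have hRfin : R✶.eRank ≠ ⊤ := PercRepro.Matroid.eRank_ne_top_of_finite R✶
  obtain ⟨dU, hdU⟩ := ENat.ne_top_iff_exists.1 hRfin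
  have hdUenc : R.E.encard = R.eRank + dU := by
    have h := _root_.Matroid.eRank_add_eRank_dual R
    rw [← hdU] at h
    exact h.symm
  -- the nullity of the restriction is `≥ 7`: the kernels at nullities `≤ 6`
  have hdU7 : 7 ≤ dU := by
    by_contra h
    push Not at h
    rcases Nat.lt_or_ge dU 6 with h6 | h6
    · have hb := ncard_triangles_le_triBound8 R hRC1 hRC2 hRC3 hdUenc
      rw [hRtri] at hb
      have h8 : triBound8 dU ≤ 8 := by
        interval_cases dU <;> decide
      omega
    · have hdU6 : dU = 6 := by omega
      rw [hdU6] at hdUenc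
      have hb := kernelSix_ncard_triangles_le_ten R hRC1 hRC2 hRC3 (by exact_mod_cast hdUenc)
      rw [hRtri] at hb
      omega
  have hrfin : M.eRk (⋃₀ ThmN.triangles M) ≠ ⊤ := by
    intro h
    have := M.eRk_le_encard (⋃₀ ThmN.triangles M)
    rw [h] at this
    exact hUfin.encard_lt_top.ne (top_le_iff.1 this)
  obtain ⟨r, hr⟩ := ENat.ne_top_iff_exists.1 hrfin
  have hnat : (⋃₀ ThmN.triangles M).ncard = r + dU := by
    have h := hdUenc
    rw [hR, _root_.Matroid.restrict_ground_eq, _root_.Matroid.eRank_restrict, ← hr,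
      ← hUfin.cast_ncard_eq] at h
    exact_mod_cast h
  -- the nullity cap: `|U| ≤ r(U) + 7`
  have hcap : (⋃₀ ThmN.triangles M).ncard ≤ r + 7 := by
    have h := PercRepro.Matroid.encard_le_eRk_add_of_encard_eq hUE hd
    rw [← hr, ← hUfin.cast_ncard_eq] at h
    exact_mod_cast h
  have hr4 : 4 ≤ r := by
    by_contra h
    push Not at h
    have h3 : M.eRk (⋃₀ ThmN.triangles M) ≤ 3 := by
      rw [← hr]
      exact_mod_cast (show r ≤ 3 by omega)
    have := hC2 _ hUE h3
    omega
  have hr5 : 5 ≤ r := by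
    by_contra h
    push Not at h
    have h4 : M.eRk (⋃₀ ThmN.triangles M) ≤ 4 := by
      rw [← hr]
      exact_mod_cast (show r ≤ 4 by omega)
    have := hC3 _ hUE h4
    omega
  exact ⟨r, hr5, hr.symm, by omega⟩

/-- **Outside points are at least four**: if `q ∈ U` lies off `cl(X)` and on `≥ 3` triangles, each of them carries a
second point off `cl(X)` (`exists_mem_notMem_closure_of_notMem_closure`), distinct for distinct triangles, so
`|U ∖ cl(X)| ≥ 4`. -/
theorem four_le_ncard_sdiff_closure (M : Matroid α) [M.Finite]
    (hC1 : ∀ L ⊆ M.E, M.eRk L = 2 → L.ncard ≤ 3) {X : Set α} {q : α}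
    (hqU : q ∈ ⋃₀ ThmN.triangles M) (hq : q ∉ M.closure X)
    (h3 : 3 ≤ (ThmN.trianglesThrough M q).ncard) :
    4 ≤ ((⋃₀ ThmN.triangles M) \ M.closure X).ncard := by
  classical
  have hSfin : (ThmN.triangles M).Finite :=
    M.ground_finite.finite_subsets.subset (fun C hC => hC.1.subset_ground)
  have hUE : ⋃₀ ThmN.triangles M ⊆ M.E := by
    intro z hz
    obtain ⟨C, hC, hzC⟩ := Set.mem_sUnion.1 hz
    exact hC.1.subset_ground hzC
  have hUfin : (⋃₀ ThmN.triangles M).Finite := M.ground_finite.subset hUE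
  set O := (⋃₀ ThmN.triangles M) \ M.closure X with hO
  have hOfin : O.Finite := hUfin.subset Set.sdiff_subset
  have hTqfin : (ThmN.trianglesThrough M q).Finite := hSfin.subset (fun C hC => ⟨hC.1, hC.2.1⟩)
  set 𝒯 : Finset (Set α) := hTqfin.toFinset with h𝒯def
  have hmemq : ∀ T, T ∈ 𝒯 ↔ T ∈ ThmN.trianglesThrough M q := fun T => Set.Finite.mem_toFinset hTqfin
  have hcardq : 3 ≤ 𝒯.card := by
    rw [h𝒯def, ← Set.ncard_eq_toFinset_card _ hTqfin]
    exact h3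
  have hDfin : (O \ {q}).Finite := hOfin.subset Set.sdiff_subset
  set K : Finset α := hDfin.toFinset with hKdef
  have hKcard : K.card = (O \ {q}).ncard := by
    rw [hKdef, ← Set.ncard_eq_toFinset_card _ hDfin]
  have hqD : q ∉ O \ {q} := fun h => h.2 (Set.mem_singleton q)
  have hK : ∀ T ∈ 𝒯, T ∩ (O \ {q}) ⊆ ↑K := by
    intro T _ z hz
    rw [hKdef, Set.Finite.coe_toFinset]
    exact hz.2
  by_contra hlt
  push Not at hlt
  have hqO : q ∈ O := ⟨hqU, hq⟩
  have hcardK : K.card < 𝒯.card := by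
    rw [hKcard, Set.ncard_sdiff' (Set.singleton_subset_iff.2 hqO) hOfin, Set.ncard_singleton]
    omega
  obtain ⟨T, hT𝒯, hTD⟩ :=
    exists_triangle_disjoint_of_card_lt M hC1 𝒯 (fun T hT => (hmemq T).1 hT) hqD K hK hcardK
  have hT : T ∈ ThmN.trianglesThrough M q := (hmemq T).1 hT𝒯
  obtain ⟨y, hyT, hyq, hycl⟩ := exists_mem_notMem_closure_of_notMem_closure M hq hT
  have hyU : y ∈ ⋃₀ ThmN.triangles M := Set.mem_sUnion.2 ⟨T, ⟨hT.1, hT.2.1⟩, hyT⟩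
  have hyO : y ∈ O \ {q} := ⟨⟨hyU, hycl⟩, fun h => hyq (Set.mem_singleton_iff.1 h)⟩
  have : y ∈ T ∩ (O \ {q}) := ⟨hyT, hyO⟩
  rw [hTD] at this
  exact this

/-- **The star-incidence count**: with the three triangles `Cᵢ, Cⱼ, C_k` through `x` (all of them), every point of `U` on
`≥ 3` triangles, at most `11` triangles avoiding `x`, and NO point of `Q = U ∖ St` in `cl(St)`: a contradiction — no
triangle avoiding `x` has two star points (its third point, in `Q`, would be in `cl(St)`), and the `6` star points off `x`,
each on `≥ 2` triangles avoiding `x`, give `≥ 12` of them. -/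
theorem false_of_forall_notMem_closure_star (M : Matroid α) [M.Finite]
    (hC1 : ∀ L ⊆ M.E, M.eRk L = 2 → L.ncard ≤ 3)
    (hC2 : ∀ X ⊆ M.E, M.eRk X ≤ 3 → X.ncard ≤ 6) {x : α} (hx : M.IsNonloop x)
    {Ci Cj Ck : Set α} (hCi : Ci ∈ ThmN.trianglesThrough M x) (hCj : Cj ∈ ThmN.trianglesThrough M x)
    (hCk : Ck ∈ ThmN.trianglesThrough M x) (hij : Ci ≠ Cj) (hik : Ci ≠ Ck) (hjk : Cj ≠ Ck)
    (hmem3 : ∀ C, C ∈ ThmN.trianglesThrough M x → C = Ci ∨ C = Cj ∨ C = Ck)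
    (hmin3 : ∀ y ∈ ⋃₀ ThmN.triangles M, 3 ≤ (ThmN.trianglesThrough M y).ncard)
    (hS₂le : {C | M.IsCircuit C ∧ C.ncard = 3 ∧ x ∉ C}.ncard ≤ 11)
    (hQcl : ∀ q ∈ (⋃₀ ThmN.triangles M) \ ({x} ∪ (Ci ∪ Cj ∪ Ck)), q ∉ M.closure ({x} ∪ (Ci ∪ Cj ∪ Ck))) :
    False := by
  classical
  set S := ThmN.triangles M with hS
  have hSfin : S.Finite :=
    M.ground_finite.finite_subsets.subset (fun C hC => hC.1.subset_ground)
  have hUE : ⋃₀ S ⊆ M.E := by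
    intro z hz
    obtain ⟨C, hC, hzC⟩ := Set.mem_sUnion.1 hz
    exact hC.1.subset_ground hzC
  have hUfin : (⋃₀ S).Finite := M.ground_finite.subset hUE
  have hxU' : x ∈ ⋃₀ S := Set.mem_sUnion.2 ⟨Ci, ⟨hCi.1, hCi.2.1⟩, hCi.2.2⟩
  set s : Finset (Set α) := {Ci, Cj, Ck} with hsdef
  have hs : ∀ C ∈ s, C ∈ ThmN.trianglesThrough M x := by
    intro C hC
    simp only [hsdef, Finset.mem_insert, Finset.mem_singleton] at hC
    rcases hC with rfl | rfl | rfl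
    · exact hCi
    · exact hCj
    · exact hCk
  have hscard : s.card = 3 := Finset.card_eq_three.2 ⟨Ci, Cj, Ck, hij, hik, hjk, rfl⟩
  obtain ⟨-, hstar_card⟩ := ThmN.eRk_le_and_ncard_eq_of_triangles M hC1 hx s hs
  rw [hscard] at hstar_card
  set St := ({x} ∪ (Ci ∪ Cj ∪ Ck) : Set α) with hSt
  have hSteq : ({x} ∪ ⋃ C ∈ s, C) = St := by
    ext z
    constructor
    · intro hz
      rcases hz with hz | hz
      · exact Or.inl hz
      · obtain ⟨C, hC, hzC⟩ := Set.mem_iUnion₂.1 hz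
        simp only [hsdef, Finset.mem_insert, Finset.mem_singleton] at hC
        rcases hC with rfl | rfl | rfl
        · exact Or.inr (Or.inl (Or.inl hzC))
        · exact Or.inr (Or.inl (Or.inr hzC))
        · exact Or.inr (Or.inr hzC)
    · intro hz
      rcases hz with hz | hz
      · exact Or.inl hz
      · refine Or.inr ?_
        rcases hz with (hz | hz) | hz
        · exact Set.mem_iUnion₂.2 ⟨Ci, by simp [hsdef], hz⟩
        · exact Set.mem_iUnion₂.2 ⟨Cj, by simp [hsdef], hz⟩
        · exact Set.mem_iUnion₂.2 ⟨Ck, by simp [hsdef], hz⟩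
  rw [hSteq] at hstar_card
  have hStU : St ⊆ ⋃₀ S := by
    intro z hz
    rcases hz with hz | hz
    · rw [Set.mem_singleton_iff.1 hz]; exact hxU'
    · rcases hz with (hz | hz) | hz
      · exact Set.mem_sUnion.2 ⟨Ci, ⟨hCi.1, hCi.2.1⟩, hz⟩
      · exact Set.mem_sUnion.2 ⟨Cj, ⟨hCj.1, hCj.2.1⟩, hz⟩
      · exact Set.mem_sUnion.2 ⟨Ck, ⟨hCk.1, hCk.2.1⟩, hz⟩
  have hStE : St ⊆ M.E := hStU.trans hUE
  have hStfin : St.Finite := hUfin.subset hStU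
  have hStcl' : St ⊆ M.closure St := M.subset_closure St hStE
  set Q := (⋃₀ S) \ St with hQ
  have hTU : ∀ T ∈ S, T ⊆ ⋃₀ S := fun T hT z hz => Set.mem_sUnion.2 ⟨T, hT, hz⟩
  set S₂ := {C | M.IsCircuit C ∧ C.ncard = 3 ∧ x ∉ C} with hS₂
  have hS₂fin : S₂.Finite := hSfin.subset (fun C hC => ⟨hC.1, hC.2.1⟩)
  have hS₂S : ∀ T ∈ S₂, T ∈ S := fun T hT => ⟨hT.1, hT.2.1⟩
  have hS₂x : ∀ T ∈ S₂, x ∉ T := fun T hT => hT.2.2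
  have hQpt : ∀ T ∈ S₂, ∃ q ∈ T, q ∈ Q := by
    intro T hT
    obtain ⟨q, hqT, hqSt⟩ := exists_mem_notMem_star_of_notMem M hC1 hC2 hx hCi hCj hCk hij hik hjk
      (hS₂S T hT) (hS₂x T hT)
    exact ⟨q, hqT, hTU T (hS₂S T hT) hqT, hqSt⟩
  -- no triangle avoiding `x` has two star points
  have hB5 : ∀ T ∈ S₂, ∀ a ∈ T, ∀ b ∈ T, a ≠ b → a ∈ St → b ∈ St → False := by
    intro T hT a haT b hbT hab haSt hbSt
    obtain ⟨c, hcT, hcQ⟩ := hQpt T hT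
    have hTcl : T ⊆ M.closure St := by
      refine (triangle_subset_closure_of_two_mem M (hS₂S T hT) haT hbT hab).trans ?_
      refine M.closure_subset_closure_of_subset_closure ?_
      intro z hz
      rcases hz with rfl | hz
      · exact hStcl' haSt
      · rw [Set.mem_singleton_iff.1 hz]; exact hStcl' hbSt
    exact hQcl c hcQ (hTcl hcT)
  -- the count
  set S₂f : Finset (Set α) := hS₂fin.toFinset with hS₂fdef
  have hmemS₂ : ∀ T, T ∈ S₂f ↔ T ∈ S₂ := fun T => Set.Finite.mem_toFinset hS₂fin
  have hS₂fcard : S₂f.card ≤ 11 := by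
    rw [hS₂fdef, ← Set.ncard_eq_toFinset_card _ hS₂fin]
    exact hS₂le
  have hAfin : (St \ {x}).Finite := hStfin.subset Set.sdiff_subset
  set A : Finset α := hAfin.toFinset with hAdef
  have hmemA : ∀ a, a ∈ A ↔ a ∈ St \ {x} := fun a => Set.Finite.mem_toFinset hAfin
  have hxSt : x ∈ St := Or.inl rfl
  have hAcard : A.card = 6 := by
    rw [hAdef, ← Set.ncard_eq_toFinset_card _ hAfin,
      Set.ncard_sdiff' (Set.singleton_subset_iff.2 hxSt) hStfin, hstar_card, Set.ncard_singleton]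
  have hf2 : ∀ a ∈ A, 2 ≤ (S₂f.filter (fun T => a ∈ T)).card := by
    intro a ha
    have ha' := (hmemA a).1 ha
    have haSt : a ∈ St := ha'.1
    have hax : a ≠ x := fun h => ha'.2 (by rw [h]; exact Set.mem_singleton x)
    have haU : a ∈ ⋃₀ S := hStU haSt
    have hTafin : (ThmN.trianglesThrough M a).Finite := hSfin.subset (fun C hC => ⟨hC.1, hC.2.1⟩)
    set Ta : Finset (Set α) := hTafin.toFinset with hTadef
    have hmema : ∀ T, T ∈ Ta ↔ T ∈ ThmN.trianglesThrough M a := fun T => Set.Finite.mem_toFinset hTafin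
    have hTacard : 3 ≤ Ta.card := by
      rw [hTadef, ← Set.ncard_eq_toFinset_card _ hTafin]
      exact hmin3 a haU
    have hsplit := Finset.card_filter_add_card_filter_not (fun T => x ∈ T) (s := Ta)
    have hle1 : (Ta.filter (fun T => x ∈ T)).card ≤ 1 := by
      rw [Finset.card_le_one]
      intro T hT T' hT'
      rw [Finset.mem_filter, hmema] at hT hT'
      by_contra hne
      have h := ThmN.inter_eq_singleton_of_mem_trianglesThrough M hC1 (x := x)
        ⟨hT.1.1, hT.1.2.1, hT.2⟩ ⟨hT'.1.1, hT'.1.2.1, hT'.2⟩ hne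
      have : a ∈ T ∩ T' := ⟨hT.1.2.2, hT'.1.2.2⟩
      rw [h] at this
      exact hax (Set.mem_singleton_iff.1 this)
    have hsub : Ta.filter (fun T => ¬ x ∈ T) ⊆ S₂f.filter (fun T => a ∈ T) := by
      intro T hT
      rw [Finset.mem_filter, hmema] at hT
      rw [Finset.mem_filter, hmemS₂]
      exact ⟨⟨hT.1.1, hT.1.2.1, hT.2⟩, hT.1.2.2⟩
    have := Finset.card_le_card hsub
    omega
  have hdisj : (↑A : Set α).PairwiseDisjoint (fun a => S₂f.filter (fun T => a ∈ T)) := by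
    intro a ha b hb hab
    rw [Function.onFun, Finset.disjoint_left]
    intro T hTa hTb
    rw [Finset.mem_filter] at hTa hTb
    have haSt : a ∈ St := ((hmemA a).1 (Finset.mem_coe.1 ha)).1
    have hbSt : b ∈ St := ((hmemA b).1 (Finset.mem_coe.1 hb)).1
    exact hB5 T ((hmemS₂ T).1 hTa.1) a hTa.2 b hTb.2 hab haSt hbSt
  have hbiU : A.biUnion (fun a => S₂f.filter (fun T => a ∈ T)) ⊆ S₂f := by
    intro T hT
    obtain ⟨a, -, hTa⟩ := Finset.mem_biUnion.1 hT
    exact (Finset.mem_filter.1 hTa).1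
  have h12 : 12 ≤ (A.biUnion (fun a => S₂f.filter (fun T => a ∈ T))).card := by
    rw [Finset.card_biUnion hdisj]
    calc 12 = ∑ _a ∈ A, 2 := by rw [Finset.sum_const, hAcard, smul_eq_mul]
      _ ≤ ∑ a ∈ A, (S₂f.filter (fun T => a ∈ T)).card := Finset.sum_le_sum hf2
  have := Finset.card_le_card hbiU
  omega

end S1

end PercRepro
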